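import Summits.Ventures.PercRepro.RankLevelSetHallRuleL
import Summits.Ventures.PercRepro.RankLevelSetRuleQSwap

/-!
# PercRepro — RULE L IS EXACT ON THE MIDDLE LEVELS: `Φ(p,q) − δ(Z)`, AND PAYS EVERY MEMBER WITH AN EMPTY FLAT PART
(p4, gen 30; C-044, UP form at the tight layer; night-1's Rule L of RankLevelSetHallRuleL; paper proofs/P4-CELL-THREE.md §14.10)

Rule L (night-1 g15) gives every member `Z` of a middle-level `Y`-set `S` (`#S < p`) the Boolean LYM share `1 / C(#S, q)`, and
splits the unit of every big `Y`-set (`#S ≥ p`) equally among its eligible members.  At the tight layer `#E = p + q` the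
middle-level receipt of a member `Z` is EXACT: the sets `S = Z ∪ X`, `X ⊆ E ∖ Z`, `1 ≤ #X ≤ p − q − 1`, lie in `Y` iff
`X ⊄ cl Z`, i.e. iff `X ⊄ flatPart Z` (`eRk_union_eq_iff_subset_closure`), so with `#(E ∖ Z) = p` and `m = #(flatPart Z)`
  `ruleLMid Z = Σ_{j=1}^{p−q−1} (C(p, j) − C(m, j)) / C(q+j, q) = Φ(p,q) − δ(Z)`,   `δ(Z) := Σ_{j=1}^{p−q−1} C(m, j)/C(q+j, q)`
(`ruleLMid_eq`; `Φ(p,q) = Σ_{j<p−q} C(p, j)/C(q+j, q)` is `phiK_eq_sum_range'`, night-1's `phiK_eq_sum_range` re-proved here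
to keep the import closure to RankLevelSetHallRuleL).  Hence
* **`ruleLRecv_eq`** — `ruleLRecv Z = Φ(p,q) − δ(Z) + ruleLBig Z` for every member at the tight layer;
* **`ruleL_pays_of_flatPart_empty`** — a member whose flat part is empty receives at least `Φ(p,q)` under Rule L: the half of
  night-1's conjecture (RL-UP) that concerns the free members is a theorem;
* **`ruleLUp_iff`** — at the tight layer Rule L pays every member iff `δ(Z) ≤ ruleLBig Z` for every member: the conjecture of
  record for the mechanism is exactly the big-set inequality of NIGHT-1-C025-induction.md §26.2.
Axioms standard.
-/

namespace PercRepro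

open Set Matroid Finset

variable {α : Type} (M : Matroid α) [M.Finite]

/-- `Σ_{u ∈ Ioo a b} f u = Σ_{u < b − (a+1)} f (a + 1 + u)`. -/
lemma sum_Ioo_nat' (a b : ℕ) (f : ℕ → ℚ) :
    ∑ u ∈ Finset.Ioo a b, f u = ∑ u ∈ Finset.range (b - (a + 1)), f (a + 1 + u) := by
  rw [← Finset.Ico_succ_left_eq_Ioo, Order.succ_eq_add_one, Finset.sum_Ico_eq_sum_range]

/-- `Φ(q + k, q) = Σ_{i < k−1} C(q+k, i+1) / C(q+i+1, q)` (night-1's `phiK_eq_sum_range`, termwise via `Nat.choose_mul`). -/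
lemma phiK_eq_sum_range' (q k : ℕ) (hk : 1 ≤ k) :
    phiK (q + k) q = ∑ i ∈ Finset.range (k - 1), ((q + k).choose (i + 1) : ℚ) / ((q + i + 1).choose q : ℚ) := by
  unfold phiK
  rw [sum_Ioo_nat', show q + k - (q + 1) = k - 1 by omega, Finset.sum_div]
  apply Finset.sum_congr rfl
  intro i hi
  rw [Finset.mem_range] at hi
  have hsym : (q + k + q).choose (q + k) = (q + k + q).choose q := by
    rw [show q + k + q = q + (q + k) by ring, Nat.choose_symm_add]
  have hmul := Nat.choose_mul (n := q + k + q) (k := q + 1 + i) (s := q) (by omega)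
  rw [show q + k + q - q = q + k by omega, show q + 1 + i - q = i + 1 by omega] at hmul
  have hpos1 : (0 : ℚ) < ((q + k + q).choose (q + k) : ℚ) := by exact_mod_cast Nat.choose_pos (by omega)
  have hpos2 : (0 : ℚ) < ((q + i + 1).choose q : ℚ) := by exact_mod_cast Nat.choose_pos (by omega)
  rw [div_eq_div_iff hpos1.ne' hpos2.ne', hsym]
  have hmul' : ((q + k + q).choose (q + 1 + i) : ℚ) * ((q + 1 + i).choose q : ℚ)
      = ((q + k + q).choose q : ℚ) * ((q + k).choose (i + 1) : ℚ) := by exact_mod_cast hmul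
  rw [show q + i + 1 = q + 1 + i by ring]
  linarith [hmul']

/-- The LYM defect of a member: `δ(Z) = Σ_{j=1}^{p−q−1} C(#flatPart Z, j) / C(q+j, q)` — the LYM weight of the supersets of
`Z` inside its closure, which Rule L's middle levels cannot pay. -/
noncomputable def lymDefect (p q : ℕ) (Z : Set α) : ℚ :=
  ∑ i ∈ range (p - q - 1), ((flatPart M Z).ncard.choose (i + 1) : ℚ) / ((q + i + 1).choose q : ℚ)

/-- Rule L's middle-level receipt of `Z`: `Σ_{S ∈ Y, Z ⊆ S, #S < p} 1 / C(#S, q)`. -/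
noncomputable def ruleLMid (p q : ℕ) (Z : Set α) : ℚ := by
  classical
  exact ∑ S ∈ (cellY_finite M p q).toFinset,
    if Z ⊆ S ∧ S.ncard < p then 1 / ((S.ncard.choose q : ℕ) : ℚ) else 0

/-- Rule L's big-set receipt of `Z`: `Σ_{S ∈ Y, Z ⊆ S, #S ≥ p, Z eligible in S} 1 / eligCount S`. -/
noncomputable def ruleLBig (p q : ℕ) (Z : Set α) : ℚ := by
  classical
  exact ∑ S ∈ (cellY_finite M p q).toFinset,
    if Z ⊆ S ∧ ¬ S.ncard < p ∧ (∃ e ∈ S, e ∉ Z ∧ M.eRk (insert e Z) = (q : ℕ∞)) then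
      1 / ((eligCount M p q S : ℕ) : ℚ) else 0

/-- Rule L's receipt splits into the middle-level and the big-set parts. -/
theorem ruleLRecv_eq_mid_add_big (p q : ℕ) {Z : Set α} (hZ : Z ∈ cellMembers M p q) :
    ruleLRecv M p q Z = ruleLMid M p q Z + ruleLBig M p q Z := by
  classical
  unfold ruleLRecv ruleLMid ruleLBig
  rw [← Finset.sum_add_distrib]
  refine Finset.sum_congr rfl (fun S hS => ?_)
  rw [(cellY_finite M p q).mem_toFinset] at hS
  unfold ruleLWeight
  by_cases hZS : Z ⊆ S
  · by_cases hsmall : S.ncard < p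
    · simp [hZ, hZS, hS, hsmall]
    · by_cases helig : ∃ e ∈ S, e ∉ Z ∧ M.eRk (insert e Z) = (q : ℕ∞)
      · simp [hZ, hZS, hS, hsmall, helig]
      · simp [hZ, hZS, hS, hsmall, helig]
  · simp [hZS]

/-- The big-set receipt is non-negative. -/
theorem ruleLBig_nonneg (p q : ℕ) (Z : Set α) : 0 ≤ ruleLBig M p q Z := by
  classical
  unfold ruleLBig
  refine Finset.sum_nonneg (fun S _ => ?_)
  split_ifs <;> positivity

/-- `eRk (Z ∪ X) = eRk Z` iff `X ⊆ cl Z` (for `Z, X ⊆ E`). -/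
lemma eRk_union_eq_iff_subset_closure {Z X : Set α} (hZ : Z ⊆ M.E) (hX : X ⊆ M.E) :
    M.eRk (Z ∪ X) = M.eRk Z ↔ X ⊆ M.closure Z := by
  constructor
  · intro h x hx
    by_contra hxc
    have h1 : M.eRk (insert x Z) = M.eRk Z + 1 := Matroid.eRk_insert_eq_add_one ⟨hX hx, hxc⟩
    have h2 : M.eRk (insert x Z) ≤ M.eRk (Z ∪ X) :=
      M.eRk_mono (Set.insert_subset (Or.inr hx) Set.subset_union_left)
    rw [h, h1] at h2
    have hfin : M.eRk Z ≠ ⊤ :=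
      ne_top_of_le_ne_top (M.set_finite Z hZ).encard_lt_top.ne (M.eRk_le_encard Z)
    exact lt_irrefl _ ((ENat.add_one_le_iff hfin).1 h2)
  · intro h
    refine le_antisymm ?_ (M.eRk_mono Set.subset_union_left)
    calc M.eRk (Z ∪ X) ≤ M.eRk (M.closure Z) := M.eRk_mono (Set.union_subset (M.subset_closure Z hZ) h)
      _ = M.eRk Z := M.eRk_closure_eq Z

omit [M.Finite] in
/-- For `X ⊆ E ∖ Z`: `X ⊆ cl Z` iff `X ⊆ flatPart Z`. -/
lemma subset_closure_iff_subset_flatPart {Z X : Set α} (hX : X ⊆ M.E \ Z) :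
    X ⊆ M.closure Z ↔ X ⊆ flatPart M Z := by
  unfold flatPart
  constructor
  · intro h x hx
    exact ⟨hX hx, h hx⟩
  · intro h x hx
    exact (h hx).2

/-- The sum of `f(#X)` over the subsets of a Finset, with `f` supported on `1 ≤ j < k`, as a sum over `j = 1 … k−1`. -/
lemma sum_powerset_supported (T : Finset α) (k : ℕ) (g : ℕ → ℚ) :
    ∑ X ∈ T.powerset, (if 1 ≤ X.card ∧ X.card < k then g X.card else 0)
      = ∑ i ∈ range (k - 1), (T.card.choose (i + 1) : ℚ) * g (i + 1) := by
  rw [Finset.sum_powerset_apply_card (fun j => if 1 ≤ j ∧ j < k then g j else 0)]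
  have hext : ∑ m ∈ range (T.card + 1), T.card.choose m • (if 1 ≤ m ∧ m < k then g m else 0)
      = ∑ m ∈ range (T.card + 1 + k), T.card.choose m • (if 1 ≤ m ∧ m < k then g m else 0) := by
    refine Finset.sum_subset (by
      intro x hx
      rw [Finset.mem_range] at hx ⊢
      omega) (fun m hm hm' => ?_)
    rw [Finset.mem_range] at hm hm'
    rw [Nat.choose_eq_zero_of_lt (by omega), zero_smul]
  rw [hext]
  have hsplit : ∑ m ∈ range (T.card + 1 + k), T.card.choose m • (if 1 ≤ m ∧ m < k then g m else 0)
      = ∑ m ∈ (range (T.card + 1 + k)).filter (fun m => 1 ≤ m ∧ m < k), (T.card.choose m : ℚ) * g m := by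
    rw [Finset.sum_filter]
    refine Finset.sum_congr rfl (fun m _ => ?_)
    split_ifs <;> simp
  rw [hsplit]
  have hfilt : (range (T.card + 1 + k)).filter (fun m => 1 ≤ m ∧ m < k) = Finset.Ico 1 k := by
    ext m
    simp only [Finset.mem_filter, Finset.mem_range, Finset.mem_Ico]
    omega
  rw [hfilt, Finset.sum_Ico_eq_sum_range]
  refine Finset.sum_congr rfl (fun i _ => ?_)
  rw [Nat.add_comm 1 i]

/-- **Rule L is exact on the middle levels**: at the tight layer a member `Z` receives exactly `Φ(p,q) − δ(Z)` from the
middle-level `Y`-sets. -/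
theorem ruleLMid_eq (p q : ℕ) (hE : M.E.ncard = p + q) (hpq : q < p) {Z : Set α} (hZ : Z ∈ cellMembers M p q) :
    ruleLMid M p q Z = phiK p q - lymDefect M p q Z := by
  classical
  -- the data of the member
  have hZE : Z ⊆ M.E := hZ.1
  have hEfin : M.E.Finite := M.ground_finite
  have hZfin : Z.Finite := hEfin.subset hZE
  have hZcard : Z.ncard = q := ncard_eq_q_of_mem_cellMembers_tight M hE hZ
  have hAcard : (M.E \ Z).ncard = p := (compl_indep_of_mem_U M hE hZ).2
  have hAfin : (M.E \ Z).Finite := hEfin.subset Set.sdiff_subset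
  have hPsub : flatPart M Z ⊆ M.E \ Z := fun x hx => hx.1
  have hPfin : (flatPart M Z).Finite := hAfin.subset hPsub
  set k := p - q with hk
  have hpk : p = q + k := by omega
  set Af : Finset α := hAfin.toFinset with hAf
  set Pf : Finset α := hPfin.toFinset with hPf
  have hAfcard : Af.card = p := by rw [hAf, ← ncard_eq_toFinset_card _ hAfin, hAcard]
  have hPfcard : Pf.card = (flatPart M Z).ncard := by rw [hPf, ← ncard_eq_toFinset_card _ hPfin]
  have hPfAf : Pf ⊆ Af := by
    intro x hx
    rw [hPf, hPfin.mem_toFinset] at hx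
    rw [hAf, hAfin.mem_toFinset]
    exact hPsub hx
  have hqZ : M.eRk Z = (q : ℕ∞) := hZ.2.1
  -- the middle-level sets containing Z ↔ the subsets X of E ∖ Z with 1 ≤ #X < k not inside the flat part
  have hmid : ruleLMid M p q Z =
      ∑ X ∈ Af.powerset.filter (fun X => 1 ≤ X.card ∧ X.card < k ∧ ¬ X ⊆ Pf),
        1 / (((q + X.card).choose q : ℕ) : ℚ) := by
    unfold ruleLMid
    rw [← Finset.sum_filter]
    symm
    refine Finset.sum_bij (fun X _ => Z ∪ (X : Set α)) ?_ ?_ ?_ ?_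
    · -- maps into the middle-level sets containing Z
      intro X hX
      rw [Finset.mem_filter, Finset.mem_powerset] at hX
      obtain ⟨hXA, hX1, hXk, hXP⟩ := hX
      have hXA' : (X : Set α) ⊆ M.E \ Z := by
        intro x hx
        have := hXA hx
        rwa [hAf, hAfin.mem_toFinset] at this
      have hXE : (X : Set α) ⊆ M.E := fun x hx => (hXA' hx).1
      have hdisj : Disjoint Z (X : Set α) := Set.disjoint_left.2 (fun x hxZ hxX => (hXA' hxX).2 hxZ)
      have hcard : (Z ∪ (X : Set α)).ncard = q + X.card := by
        rw [Set.ncard_union_eq hdisj hZfin X.finite_toSet, hZcard, Set.ncard_coe_finset]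
      have hnotcl : ¬ (X : Set α) ⊆ M.closure Z := by
        rw [subset_closure_iff_subset_flatPart M hXA']
        intro h
        apply hXP
        intro x hx
        rw [hPf, hPfin.mem_toFinset]
        exact h hx
      have hgt : (q : ℕ∞) < M.eRk (Z ∪ (X : Set α)) := by
        have hne : M.eRk (Z ∪ (X : Set α)) ≠ M.eRk Z := fun h =>
          hnotcl ((eRk_union_eq_iff_subset_closure M hZE hXE).1 h)
        have hle : M.eRk Z ≤ M.eRk (Z ∪ (X : Set α)) := M.eRk_mono Set.subset_union_left
        rw [hqZ] at hne hle
        exact lt_of_le_of_ne hle (Ne.symm hne)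
      have hlt : M.eRk (Z ∪ (X : Set α)) < (p : ℕ∞) := by
        calc M.eRk (Z ∪ (X : Set α)) ≤ (Z ∪ (X : Set α)).encard := M.eRk_le_encard _
          _ = ((Z ∪ (X : Set α)).ncard : ℕ∞) := (hZfin.union X.finite_toSet).cast_ncard_eq.symm
          _ = ((q + X.card : ℕ) : ℕ∞) := by rw [hcard]
          _ < (p : ℕ∞) := by exact_mod_cast (show q + X.card < p by omega)
      rw [Finset.mem_filter, (cellY_finite M p q).mem_toFinset]
      refine ⟨⟨Set.union_subset hZE hXE, hgt, hlt⟩, Set.subset_union_left, ?_⟩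
      rw [hcard]; omega
    · -- injective
      intro X₁ hX₁ X₂ hX₂ heq
      rw [Finset.mem_filter, Finset.mem_powerset] at hX₁ hX₂
      have h1 : ∀ X : Finset α, X ⊆ Af → (Z ∪ (X : Set α)) \ Z = (X : Set α) := by
        intro X hXA
        ext x
        constructor
        · intro hx
          rcases hx.1 with hxZ | hxX
          · exact absurd hxZ hx.2
          · exact hxX
        · intro hx
          have := hXA hx
          rw [hAf, hAfin.mem_toFinset] at this
          exact ⟨Or.inr hx, this.2⟩
      have h2 : (Z ∪ (X₁ : Set α)) \ Z = (Z ∪ (X₂ : Set α)) \ Z := by rw [heq]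
      rw [h1 X₁ hX₁.1, h1 X₂ hX₂.1] at h2
      exact Finset.coe_inj.1 h2
    · -- surjective
      intro S hS
      rw [Finset.mem_filter, (cellY_finite M p q).mem_toFinset] at hS
      obtain ⟨⟨hSE, hqS, hSp⟩, hZS, hScard⟩ := hS
      have hSfin : S.Finite := hEfin.subset hSE
      have hXfin : (S \ Z).Finite := hSfin.subset Set.sdiff_subset
      refine ⟨hXfin.toFinset, ?_, ?_⟩
      · rw [Finset.mem_filter, Finset.mem_powerset]
        have hXA : hXfin.toFinset ⊆ Af := by
          intro x hx
          rw [hXfin.mem_toFinset] at hx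
          rw [hAf, hAfin.mem_toFinset]
          exact ⟨hSE hx.1, hx.2⟩
        have hScard' : S.ncard = q + hXfin.toFinset.card := by
          rw [← ncard_eq_toFinset_card _ hXfin, ← hZcard, ← Set.ncard_union_eq (Set.disjoint_sdiff_right) hZfin hXfin,
            Set.union_sdiff_cancel hZS]
        refine ⟨hXA, ?_, by omega, ?_⟩
        · by_contra h0
          have h0' : hXfin.toFinset.card = 0 := by omega
          rw [Finset.card_eq_zero, hXfin.toFinset_eq_empty] at h0'
          have hSZ : S = Z := by
            rw [← Set.union_sdiff_cancel hZS, h0', Set.union_empty]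
          rw [hSZ, hqZ] at hqS
          exact lt_irrefl _ hqS
        · intro hXP
          have hXcl : (S \ Z) ⊆ M.closure Z := by
            rw [subset_closure_iff_subset_flatPart M (fun x hx => ⟨hSE hx.1, hx.2⟩)]
            intro x hx
            have := hXP (hXfin.mem_toFinset.2 hx)
            rwa [hPf, hPfin.mem_toFinset] at this
          have := (eRk_union_eq_iff_subset_closure M hZE (fun x hx => hSE hx.1)).2 hXcl
          rw [Set.union_sdiff_cancel hZS, hqZ] at this
          rw [this] at hqS
          exact lt_irrefl _ hqS
      · show Z ∪ ((hXfin.toFinset : Finset α) : Set α) = S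
        rw [Set.Finite.coe_toFinset]
        exact Set.union_sdiff_cancel hZS
    · -- the values agree
      intro X hX
      rw [Finset.mem_filter, Finset.mem_powerset] at hX
      have hXA' : (X : Set α) ⊆ M.E \ Z := by
        intro x hx
        have := hX.1 hx
        rwa [hAf, hAfin.mem_toFinset] at this
      have hdisj : Disjoint Z (X : Set α) := Set.disjoint_left.2 (fun x hxZ hxX => (hXA' hxX).2 hxZ)
      rw [Set.ncard_union_eq hdisj hZfin X.finite_toSet, hZcard, Set.ncard_coe_finset]
  -- split off the subsets inside the flat part
  have hsplit : ∑ X ∈ Af.powerset.filter (fun X => 1 ≤ X.card ∧ X.card < k ∧ ¬ X ⊆ Pf),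
        1 / (((q + X.card).choose q : ℕ) : ℚ)
      = ∑ X ∈ Af.powerset, (if 1 ≤ X.card ∧ X.card < k then 1 / (((q + X.card).choose q : ℕ) : ℚ) else 0)
        - ∑ X ∈ Pf.powerset, (if 1 ≤ X.card ∧ X.card < k then 1 / (((q + X.card).choose q : ℕ) : ℚ) else 0) := by
    rw [← Finset.sum_filter, ← Finset.sum_filter]
    have hPfpow : Pf.powerset.filter (fun X => 1 ≤ X.card ∧ X.card < k)
        = (Af.powerset.filter (fun X => 1 ≤ X.card ∧ X.card < k)).filter (fun X => X ⊆ Pf) := by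
      ext X
      simp only [Finset.mem_filter, Finset.mem_powerset]
      constructor
      · intro h; exact ⟨⟨h.1.trans hPfAf, h.2⟩, h.1⟩
      · intro h; exact ⟨h.2, h.1.2⟩
    rw [hPfpow, eq_sub_iff_add_eq, ← Finset.sum_filter_add_sum_filter_not
      (Af.powerset.filter (fun X => 1 ≤ X.card ∧ X.card < k)) (fun X => X ⊆ Pf), add_comm]
    congr 1
    · congr 1
      ext X
      simp only [Finset.mem_filter, Finset.mem_powerset]
      tauto
  have hA := sum_powerset_supported Af k (fun j => 1 / (((q + j).choose q : ℕ) : ℚ))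
  have hP := sum_powerset_supported Pf k (fun j => 1 / (((q + j).choose q : ℕ) : ℚ))
  rw [hmid, hsplit, hA, hP, hAfcard, hPfcard]
  unfold lymDefect
  rw [hpk, phiK_eq_sum_range' q k (by omega), show q + k - q - 1 = k - 1 by omega]
  congr 1 <;> refine Finset.sum_congr rfl (fun i _ => ?_) <;>
    rw [show q + (i + 1) = q + i + 1 by ring, mul_one_div]

/-- **`ruleLRecv = Φ − δ + big`** for every member at the tight layer. -/
theorem ruleLRecv_eq (p q : ℕ) (hE : M.E.ncard = p + q) (hpq : q < p) {Z : Set α} (hZ : Z ∈ cellMembers M p q) :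
    ruleLRecv M p q Z = phiK p q - lymDefect M p q Z + ruleLBig M p q Z := by
  rw [ruleLRecv_eq_mid_add_big M p q hZ, ruleLMid_eq M p q hE hpq hZ]

/-- **Rule L pays every member with an empty flat part** (at the tight layer): the free half of (RL-UP) is a theorem. -/
theorem ruleL_pays_of_flatPart_empty (p q : ℕ) (hE : M.E.ncard = p + q) (hpq : q < p) {Z : Set α}
    (hZ : Z ∈ cellMembers M p q) (hP : flatPart M Z = ∅) : phiK p q ≤ ruleLRecv M p q Z := by
  rw [ruleLRecv_eq M p q hE hpq hZ]
  have hδ : lymDefect M p q Z = 0 := by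
    unfold lymDefect
    rw [hP, Set.ncard_empty]
    refine Finset.sum_eq_zero (fun i _ => ?_)
    rw [Nat.choose_eq_zero_of_lt (by omega)]
    simp
  rw [hδ, sub_zero]
  exact le_add_of_nonneg_right (ruleLBig_nonneg M p q Z)

/-- **The conjecture of record, reduced**: at the tight layer Rule L pays every member iff every member's big-set receipt
covers its LYM defect. -/
theorem ruleLUp_iff (p q : ℕ) (hE : M.E.ncard = p + q) (hpq : q < p) :
    RuleLUp M p q ↔ ∀ Z ∈ cellMembers M p q, lymDefect M p q Z ≤ ruleLBig M p q Z := by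
  unfold RuleLUp
  constructor
  · intro h Z hZ
    have := h Z hZ
    rw [ruleLRecv_eq M p q hE hpq hZ] at this
    linarith
  · intro h Z hZ
    rw [ruleLRecv_eq M p q hE hpq hZ]
    have := h Z hZ
    linarith

end PercRepro
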